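import Summits.KontsevichZagierPeriods.KontsevichZagierPeriods.Theorems.LinRedNormalFormArrangementNormalFormStubRebaseSimpleZeroNestedBlowUpMove

/-!
# Stub `stub_rebaseSimpleZeroTwo`, part `rebaseSimpleZero_nestedBlowUp` (crux `ArrangementNormalForm`,
line `janus-bands`, v6.2) — assembly `NestedBlowUp`

The PINCH-VERTEX BLOW-UP MOVE for a clean nested pair `A < tᵢ < tⱼ < B` of a literal `GS 0 2`
datum (drefute g3, §5), in the form used by the nested common-slope dissection: over the cell
`{0 < ε₁ (y − y₀) < δ}` with both affine bounds through the pinch vertex `(y₀, t₀)` (slopes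
`α, β` weakly on one side of `0`, i.e. the pinch piece is not separable by the section `t₀`),
the simple base pole AT `y₀`, all letters `y`-free and SOME fibre carrying the pole `t = t₀`
through the vertex, the representation is congruent modulo `KZ.relations` to the subgroup
generated by the literal class `GG 0 2 2` (`rebaseSimpleZero_nestedBlowUp`, stated on the literal
class text). If the pole through the vertex sits on the
inner fibre this is `RebaseNest.blowNest_inner` (brick `NestedBlowUpMove`: one rational change
of variables + one affine pull-back); if it sits on the outer fibre, the reflection `t ↦ −t` of
both fibres (`RebasePos.pull` with `μ = −1`, rule 2) swaps inner and outer first.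

Remark (scope). If the base pole is NOT at `y₀` (`ℓ₂ ≠ y₀`) the factor `1/(y − ℓ₂)` is a unit
near `y₀` and the blow-up `y − y₀ = ε Z/b` turns it into the non-affine `b/(ε Z + (y₀ − ℓ₂) b)`:
that configuration is not a blow-up case (it is `RebaseNest.pinchAbove` territory when no letter
passes through the vertex).

References: M. Kontsevich, D. Zagier, *Periods* (2001), §1.2, rule (2).
-/

noncomputable section

open Set MeasureTheory MvPolynomial
open Literature.NumberTheory.Transcendental Literature.ModelTheory.ExponentialFields

namespace Summit.KontsevichZagierPeriods.ArrangementNormalForm.JanusBands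

namespace RebaseNest

open SeparatePos RebasePos

section Reflect

/-- The reflected constant letter `t₀` is the constant letter `−t₀`. [folklore] -/
theorem neg_const_letter (t₀ : ℚ) :
    -(((fun _ => 0), t₀) : (Fin (0 + 1) → ℚ) × ℚ) = ((fun _ => 0), -t₀) :=
  Prod.ext (funext fun _ => neg_zero) rfl

/-- A negated one-dimensional-base affine form evaluates to the negative. [folklore] -/
theorem affF_neg₂ (c : (Fin (0 + 1) → ℚ) × ℚ) (z : Fin (0 + 1 + 2) → ℝ) :
    affF 0 2 (-c) z = -affF 0 2 c z := by
  rw [RebaseZero.affF_eq, RebaseZero.affF_eq, RebaseZero.ev_neg]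

end Reflect

end RebaseNest

open SeparatePos RebasePos RebaseNest in
/-- **Registered part of `stub_rebaseSimpleZeroTwo` (line `janus-bands`, v6.2): the pinch-vertex
blow-up move** (drefute g3, §5). For a literal `GS 0 2` datum with simple base pole AT `y₀`
(`n₁ = 0`, `n₂ = 1`, `ℓ₂ = y₀`) and a clean nested pair `A < tᵢ < tⱼ < B` (`hloi … hhij`) over a
base cell which is exactly `{0 < ε₁ (y − y₀) < δ}` (`hM`, `ε₁ = ±1`, `δ > 0`), whose bounds pass
through the pinch vertex `(y₀, t₀)`: `A = t₀ + α (y − y₀)`, `B = t₀ + β (y − y₀)` (`hA`, `hB`)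
with `α, β` weakly on one side of `0` (`hside`: the piece is not separable by the section `t₀`),
with `y`-free letters (`ha0`) one of which has the value `t₀` (`hpin`: a pole through the vertex), the
representation is congruent modulo `KZ.relations` to the subgroup generated by the literal class
`GG 0 2 2`: ONE rational change of variables
`(y, tᵢ, tⱼ) = (y₀ + ε Z/b, t₀ + ε a Z/b, t₀ + ε Z)` (Jacobian `Z²/|b|³`) onto the literal product
cell `[ε₁ α < ε₁ b < ε₁ β; a between α and b; 0 < Z < δ |b|]` with integrand `± c/(b a (Z − μ'))`,
then one affine pull-back; preceded by the reflection of both fibres when the pole through the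
vertex sits on the outer fibre. Unit test (g3): `[{1<y<2, y<t₁<t₂<3y−2}, 1/((y−1)(t₁−1)(t₂−5))]`
(`y₀ = t₀ = 1`, `α = 1`, `β = 3`, `ε₁ = δ = 1`, pole `t₁ = 1` on the inner fibre) `↦
[{1<a<b<3, 0<Z<b}, 1/(a b (Z−4))]`. [Kontsevich–Zagier 2001, §1.2, rule (2)] -/
theorem rebaseSimpleZero_nestedBlowUp (m m' n₁ n₂ : ℕ) (s : KZ.IntegralRep (0 + 1 + 2)) (M : Fin m' → (Fin (0 + 1) → ℚ) × ℚ) (L : Fin m → (Fin 0 → ℚ) × ℚ) (e : Fin m → ℕ) (p : MvPolynomial (Fin 0) ℚ) (ℓ₁ ℓ₂ : (Fin 0 → ℚ) × ℚ) (a : Fin 2 → Option ((Fin (0 + 1) → ℚ) × ℚ)) (lo hi : Fin 2 → Fin 2 ⊕ ((Fin (0 + 1) → ℚ) × ℚ)) (h1 : n₁ = 0) (hn : n₂ = 1) (hbd : Bornology.IsBounded s.domain) (hdom : s.domain = SeparatePos.gDom 0 2 m' M lo hi) (hint : EqOn s.integrand (RebasePos.glit 0 2 p L e ℓ₁ ℓ₂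 n₁ n₂ a) s.domain) (i j : Fin 2) (hij : i ≠ j) (A Bd : (Fin (0 + 1) → ℚ) × ℚ) (hloi : lo i = Sum.inr A) (hhii : hi i = Sum.inl j) (hloj : lo j = Sum.inl i) (hhij : hi j = Sum.inr Bd) (y₀ t₀ α β δ ε₁ : ℚ) (hε₁ : ε₁ = 1 ∨ ε₁ = -1) (hδ : 0 < δ) (hside : (0 ≤ α ∧ 0 ≤ β) ∨ (α ≤ 0 ∧ β ≤ 0)) (hM : ∀ z : Fin (0 + 1 + 2) → ℝ, (∀ r, 0 < SeparatePos.affF 0 2 (M r) z) ↔ (0 < (ε₁ : ℝ) * (z (Fin.castAdd 2 (Fin.last 0)) - y₀) ∧ (ε₁ : ℝ) * (z (Fin.castAdd 2 (Fin.last 0)) - y₀) < δ)) (hA : ∀ z : Fin (0 + 1 + 2) → ℝ, SeparatePos.affF 0 2 A z = t₀ + α * (z (Fin.castAdd 2 (Fin.last 0)) - y₀)) (hB : ∀ z : Fin (0 + 1 + 2) → ℝ, SeparatePos.affF 0 2 Bd z = t₀ + β * (z (Fin.castAdd 2 (Fin.last 0)) - y₀)) (hℓ₂ : ℓ₂.2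 = y₀) (ha0 : ∀ l c, a l = some c → c.1 (Fin.last 0) = 0) (hpin : ∃ l c, a l = some c ∧ c.2 = t₀) : ∃ c ∈ AddSubgroup.closure (SeparatePos.GGset 0 2 2), KZ.of s - c ∈ KZ.relations := by
  obtain ⟨σ, hσ, hα, hβ⟩ : ∃ σ : ℚ, (σ = 1 ∨ σ = -1) ∧ 0 ≤ σ * α ∧ 0 ≤ σ * β := by
    rcases hside with ⟨hα, hβ⟩ | ⟨hα, hβ⟩
    · exact ⟨1, Or.inl rfl, by linarith, by linarith⟩
    · exact ⟨-1, Or.inr rfl, by linarith, by linarith⟩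
  obtain ⟨l, c, hl, hc2⟩ := hpin
  obtain rfl : c = ((fun _ => 0), t₀) :=
    Prod.ext (funext fun j => by rw [RebaseZero.eq_last j]; exact ha0 l c hl) hc2
  rcases fin_two_eq_or hij l with rfl | rfl
  · -- the pole through the vertex sits on the inner fibre: blow up directly
    exact blowNest_inner s M L e p ℓ₁ ℓ₂ a lo hi h1 hn hdom hint hij A Bd hloi hhii hloj hhij y₀ t₀ α β δ ε₁
      σ hε₁ hσ hδ hα hβ hM hA hB hℓ₂ hl (ha0 _)
  · -- the pole sits on the outer fibre: reflect both fibres (rule 2), which swaps inner/outer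
    obtain ⟨s', -, -, hdom', hint', hrel⟩ := pull (fun _ : Fin 2 => (-1 : ℚ)) (fun _ => (0 : ℚ))
      (fun _ => (0 : (Fin 0 → ℚ) × ℚ)) s M L e p ℓ₁ ℓ₂ n₁ n₂ a lo hi hbd hdom hint (fun _ => by norm_num)
      (fun _ _ _ => ⟨rfl, rfl, rfl⟩)
    have hneg : ¬((0 : ℚ) < -1) := by norm_num
    refine good_of_sub_mem hrel (blowNest_inner s' M L e _ ℓ₁ ℓ₂ _ _ _ h1 hn hdom' hint' hij.symm (-Bd)
      (-A) ?_ ?_ ?_ ?_ y₀ (-t₀) (-β) (-α) δ ε₁ (-σ) hε₁ ?_ hδ ?_ ?_ hM (fun z => ?_) (fun z => ?_) hℓ₂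
      ?_ fun c hc => ?_)
    · simp [pullLo, hneg, hhij, RebaseZero.pullC_neg_one]
    · simp [pullHi, hneg, hloj]
    · simp [pullLo, hneg, hhii]
    · simp [pullHi, hneg, hloi, RebaseZero.pullC_neg_one]
    · rcases hσ with rfl | rfl <;> norm_num
    · rw [neg_mul_neg]; exact hβ
    · rw [neg_mul_neg]; exact hα
    · rw [affF_neg₂, hB z]; push_cast; ring
    · rw [affF_neg₂, hA z]; push_cast; ring
    · simp only [pullA, hl, Option.map_some, RebaseZero.pullC_neg_one, neg_const_letter]
    · simp only [pullA] at hc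
      rcases h : a i with _ | c₀
      · simp [h] at hc
      · simp only [h, Option.map_some, Option.some.injEq] at hc
        rw [← hc, pullC_fst_last, ha0 _ c₀ h]
        norm_num

end Summit.KontsevichZagierPeriods.ArrangementNormalForm.JanusBands
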